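import Summits.HodgeConjecture.HodgeConjecture.Theorems.F0P6aRoofCwKernelKernelReadingRank
import Literature.NumberTheory.NumberFields.GaloisConjugatePrimeIdealArithmetic
import HarnessLib

/-!
# `F0P6aRoofCwKernel` — ★ RE-HOME of `Lines/F0_P6a_RoofCwKernel.lean` (tree ED. 2 sha16 20fefc6bd4d6200a), PART 2 of 2 — tree lines :358–:515 (LAST part: the module the `Lines/` shim and consumers import; it transitively carries parts 1–1).

See PART 1 `Theorems/F0P6aRoofCwKernelKernelReadingRank.lean` for the full ★ re-home header and the original module docstring (verbatim there).  Same namespace (every fully-qualified name unchanged);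
the scopes open at the cut (`noncomputable section` ∕ `namespace` ∕ `section`s) are re-opened below with their `variable` ∕ `open` ∕ `set_option` ∕ `omit` ∕ `include` ∕ `universe` lines
replayed verbatim from the tree, in order; the code after the replay block is the tree bytes :358–:515, untouched.  HC_CM is proved only modulo the 7 printed citations (2 remaining: hLiu418 = stmt-HodgeConjecture-24832, h413 = stmt-HodgeConjecture-24833) until rung 0 closes; a re-home is count-neutral.
-/

-- ── replay of the scopes open at tree line :358 (verbatim) ──
set_option autoImplicit false
set_option linter.dupNamespace false
noncomputable section
namespace Summit.HodgeConjecture.HodgeConjecture.Cruxes.HLiu418.F0P6aRoofCwKernel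
open CategoryTheory CategoryTheory.Limits AlgebraicGeometry NumberField IsDedekindDomain MulAction
open scoped Matrix Pointwise MonoidalCategory MonObj CategoryTheory.Obj
open Literature.NumberTheory.GaloisRepresentations
open Literature.NumberTheory.Automorphic Literature.NumberTheory.Automorphic.UnitaryGroup
open Literature.AlgebraicGeometry.ShimuraVarieties.UnitaryCanonicalModel
open Literature.NumberTheory.Automorphic.Liu2021.AppendixC
open Literature.AlgebraicGeometry.Motives (AlgPoints IntegralModel SchemeOver thickening thickeningLift specOver relFrobeniusOver frobeniusTwistOver frobSpec)
open Literature.NumberTheory.DiophantineGeometry (geomResidueField specResidueField)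
open Literature.AlgebraicGeometry.RelativeSpec (ActionOver)
open Literature.AlgebraicGeometry.GroupSchemes.AffineGroupScheme (Alg quotIncl)
open Literature.AlgebraicGeometry.AbelianSchemes Literature.AlgebraicGeometry.AbelianSchemes.AbelianSchemeOver
open Summit.HodgeConjecture.HodgeConjecture.Cruxes.HLiu418.F0P6aModuliDatumDefs
open Summit.HodgeConjecture.HodgeConjecture.Cruxes.HLiu418.F0P6aRGDAssembly
open Summit.HodgeConjecture.HodgeConjecture.Cruxes.HLiu418.F0P6aDatumOfInputs
variable {F : Type} [Field F] [NumberField F] [IsCMField F] [IsGalois ℚ F] {ι₁ : F →+* ℂ}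
    {Jstar : Matrix (Fin 2) (Fin 2) F}
    {K₀ : C5.OpenCompactSubgroup ↥(finAdelic ↥(maximalRealSubfield F) F (IsCMField.complexConj F) 2 Jstar)}
    {S : RecordSystemGS F Jstar ι₁ K₀} {hU7ₛ : S.HeckeTranslateDefinedOver}
    {hJ : (Jstar.map (IsCMField.complexConj F))ᵀ = Jstar} {hJu : IsUnit Jstar}
    {Fi : Type} [Field Fi] [Algebra F Fi] {Kc : C5.SmallLevel K₀} {G : Type} [Group G]
    {𝓜 : IntegralModel (𝓞 F) F ((thickening F Fi).obj (S.M.obj Kc))}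
    {w : HeightOneSpectrum (𝓞 F)} {hw : (IsCMField.complexConj F) • w ≠ w} {h𝓨 : (𝓜.localise w).IsSmoothProper 1}
    {θ : ActionOver (𝓜.localise w).total.hom ((Fi ≃ₐ[F] Fi) × G)}
    {e : Fi →ₐ[F] AlgebraicClosure (w.adicCompletion F)}
section KernelReadingRank
variable (I : RGDInputsAt F ι₁ Jstar K₀ S hU7ₛ hJ hJu Fi Kc G 𝓜 w hw h𝓨 θ e) [ExpChar (geomResidueField w) I.pChar]
open Literature.AlgebraicGeometry.AbelianSchemes.DockKernelReading
-- ── tree bytes :358–:515 ──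

set_option backward.isDefEq.respectTransparency false in
set_option maxHeartbeats 400000 in
/-- **§3d THE (E) SOCKET, LITERAL FROBENIUS INSTANCE: `Ker q̄ ∩ L = Ker F_q ∩ L`** — the currency of §2's binders `hF` (dock Frobenius law) and `hsat`
(Frobenius saturation); ★ (ED. 2) `points_iff_points_of_layer_comp_eq_one` (both dock clauses right-associated: no re-association inside the Frobenius terms here).
(Budget as §2: the `One (T ⟶ A_x̄^{(q)})` instance on the base change along `Spec Frob^f`.) [cite: Liu2021, Prop. D.8 (3) pp. 136–138]
[cite: SGA3I, VII_A 4.1] -/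
theorem points_iff_points_of_layer_of_frobenius (𝔡 : ∀ xbar, DockAt I xbar) (xbar : AlgPoints (𝓜.localise w).reductionAt (geomResidueField w))
    {Y : SchemeOver (geomResidueField w)} [GrpObj Y] (qbar : (sch₀Of 𝓜 w I.univ xbar).X ⟶ Y)
    (hdock : ∀ ⦃T : SchemeOver (geomResidueField w)⦄ (t : T ⟶ (𝔡 xbar).G₀),
      haveI := (𝔡 xbar).aff₀
      t ≫ (𝔡 xbar).ι₀G ≫ qbar = 1 ↔ ∃ s, s ≫ quotIncl (𝔡 xbar).G₀ (kerFOf I 𝔡 xbar).1 = t)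
    (hF : ∀ ⦃T : SchemeOver (geomResidueField w)⦄ (t : T ⟶ (𝔡 xbar).G₀),
      t ≫ (𝔡 xbar).ι₀G ≫ relFrobeniusOver I.pChar I.fDeg (sch₀Of 𝓜 w I.univ xbar).X =
          (1 : T ⟶ ((sch₀Of 𝓜 w I.univ xbar).baseChange (frobSpec (geomResidueField w) I.pChar I.fDeg)).X) ↔
        haveI := (𝔡 xbar).aff₀
        ∃ s, s ≫ quotIncl (𝔡 xbar).G₀ (kerFOf I 𝔡 xbar).1 = t)
    (hkerq : ∀ ⦃T : SchemeOver (geomResidueField w)⦄ (z : T ⟶ (sch₀Of 𝓜 w I.univ xbar).X), z ≫ qbar = 1 →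
      ∀ b ∈ w.asIdeal * ((IsCMField.complexConj F) • w).asIdeal, z ≫ (act₀Of 𝓜 w I.univ I.act b xbar).hom.hom.hom = 1)
    (hsat : ∀ (n : ℕ) ⦃T : SchemeOver (geomResidueField w)⦄ (x : T ⟶ (sch₀Of 𝓜 w I.univ xbar).X),
      (∀ b ∈ ((IsCMField.complexConj F) • w).asIdeal ^ n, x ≫ (act₀Of 𝓜 w I.univ I.act b xbar).hom.hom.hom = 1) →
      x ≫ relFrobeniusOver I.pChar I.fDeg (sch₀Of 𝓜 w I.univ xbar).X =
          (1 : T ⟶ ((sch₀Of 𝓜 w I.univ xbar).baseChange (frobSpec (geomResidueField w) I.pChar I.fDeg)).X) →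
      ∀ b ∈ ((IsCMField.complexConj F) • w).asIdeal, x ≫ (act₀Of 𝓜 w I.univ I.act b xbar).hom.hom.hom = 1)
    (n : ℕ) {L : SchemeOver (geomResidueField w)} (jl : L ⟶ (sch₀Of 𝓜 w I.univ xbar).X)
    (hL : ∀ ⦃T : SchemeOver (geomResidueField w)⦄ (y : T ⟶ L),
      ∀ b ∈ ((IsCMField.complexConj F) • w).asIdeal ^ n, (y ≫ jl) ≫ (act₀Of 𝓜 w I.univ I.act b xbar).hom.hom.hom = 1)
    {K : SchemeOver (geomResidueField w)} (κ : K ⟶ L)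
    (hκ : ∀ ⦃T : SchemeOver (geomResidueField w)⦄ (y : T ⟶ L), (∃ c : T ⟶ K, c ≫ κ = y) ↔ (y ≫ jl) ≫ qbar = 1)
    {Φ : SchemeOver (geomResidueField w)} (φ : Φ ⟶ L)
    (hφ : ∀ ⦃T : SchemeOver (geomResidueField w)⦄ (y : T ⟶ L), (∃ c : T ⟶ Φ, c ≫ φ = y) ↔
      (y ≫ jl) ≫ relFrobeniusOver I.pChar I.fDeg (sch₀Of 𝓜 w I.univ xbar).X =
          (1 : T ⟶ ((sch₀Of 𝓜 w I.univ xbar).baseChange (frobSpec (geomResidueField w) I.pChar I.fDeg)).X)) :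
    ∀ ⦃T : SchemeOver (geomResidueField w)⦄ (y : T ⟶ L), (∃ c : T ⟶ Φ, c ≫ φ = y) ↔ ∃ c : T ⟶ K, c ≫ κ = y := by
  letI := (𝔡 xbar).grp₀
  haveI := (𝔡 xbar).aff₀
  intro T y
  -- both readings put the point on the dock: (hker-DOWN) + §0a, resp. the Frobenius saturation of the block
  have hkerdown : ∀ ⦃T : SchemeOver (geomResidueField w)⦄ (y : T ⟶ L), (y ≫ jl) ≫ qbar = 1 →
      ∀ r ∈ ((IsCMField.complexConj F) • w).asIdeal,
        (y ≫ jl) ≫ ((I.act.baseChange (pullback.fst (𝓜.localise w).total.hom (specResidueField w))).baseChange xbar.left).i r = 1 := by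
    intro T y hy r hr
    have hsup : ∀ b ∈ w.asIdeal * ((IsCMField.complexConj F) • w).asIdeal ⊔ ((IsCMField.complexConj F) • w).asIdeal ^ n,
        (y ≫ jl) ≫ ((I.act.baseChange (pullback.fst (𝓜.localise w).total.hom (specResidueField w))).baseChange xbar.left).i b = 1 :=
      (RingAction.forall_mem_sup_iff _ (y ≫ jl)).2
        ⟨fun b hb => by rw [← act₀Of_hom_hom_hom]; exact hkerq (y ≫ jl) hy b hb, fun b hb => by rw [← act₀Of_hom_hom_hom]; exact hL y b hb⟩
    exact hsup r (smul_asIdeal_le_mul_sup_pow hw n hr)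
  have hFdown : ∀ ⦃T : SchemeOver (geomResidueField w)⦄ (y : T ⟶ L),
      (y ≫ jl) ≫ relFrobeniusOver I.pChar I.fDeg (sch₀Of 𝓜 w I.univ xbar).X =
          (1 : T ⟶ ((sch₀Of 𝓜 w I.univ xbar).baseChange (frobSpec (geomResidueField w) I.pChar I.fDeg)).X) →
      ∀ r ∈ ((IsCMField.complexConj F) • w).asIdeal,
        (y ≫ jl) ≫ ((I.act.baseChange (pullback.fst (𝓜.localise w).total.hom (specResidueField w))).baseChange xbar.left).i r = 1 := by
    intro T y hy r hr
    rw [← act₀Of_hom_hom_hom]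
    exact hsat n (y ≫ jl) (hL y) hy r hr
  exact points_iff_points_of_layer_comp_eq_one (W := ((sch₀Of 𝓜 w I.univ xbar).baseChange (frobSpec (geomResidueField w) I.pChar I.fDeg)).X)
    _ _ ((IsCMField.complexConj F) • w).asIdeal (𝔡 xbar).G₀ (𝔡 xbar).ι₀G (𝔡 xbar).hkerG₀ (kerFOf I 𝔡 xbar).1 qbar hdock
    (relFrobeniusOver I.pChar I.fDeg (sch₀Of 𝓜 w I.univ xbar).X) hF jl hkerdown hFdown κ hκ φ hφ y

end KernelReadingRank

/-! ### §4 (hsat) FROBENIUS SATURATION OF THE `c•w` BLOCK — the binder `hsat` of `hlaw_cw_of_dockClauses` from the dock + (R-unr) (LA3-p02 (g3); ★ p850080) -/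

section HsatIdeals

/-- **An UNRAMIFIED maximal ideal `P ∋ x` of a Dedekind domain (`P² ∤ (x)`) satisfies `P ≤ P² + (x)`**: `(x) = P·J` with `P ∤ J`, so `P + J = ⊤` and
`P = P(P + J) = P² + (x)`. [cite: Neukirch1999, Ch. I §3 (3.6)] -/
theorem le_sq_sup_span_of_not_sq_dvd {O : Type*} [CommRing O] [IsDedekindDomain O] {P : Ideal O} (hP : P.IsMaximal) {x : O} (hx : x ∈ P)
    (h : ¬ P ^ 2 ∣ Ideal.span {x}) : P ≤ P ^ 2 ⊔ Ideal.span {x} := by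
  obtain ⟨J, hJ⟩ : P ∣ Ideal.span {x} := (Ideal.dvd_span_singleton).2 hx
  have hPJ : ¬ J ≤ P := fun hle => h (by
    obtain ⟨K, hK⟩ := (Ideal.dvd_iff_le).2 hle
    exact ⟨K, by rw [hJ, hK, ← mul_assoc, sq]⟩)
  have hsup : P ⊔ J = ⊤ := by
    refine hP.out.2 _ (lt_of_le_of_ne le_sup_left fun heq => hPJ ?_)
    rw [heq]; exact le_sup_right
  calc P = P * (P ⊔ J) := by rw [hsup, Ideal.mul_top]
    _ = P ^ 2 ⊔ Ideal.span {x} := by rw [Ideal.mul_sup, ← sq, ← hJ]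
    _ ≤ P ^ 2 ⊔ Ideal.span {x} := le_rfl

variable {F : Type} [Field F] [NumberField F] [IsCMField F] (w : HeightOneSpectrum (𝓞 F))

-- (K6 ★ twin — gate `dedup.landed`, dealer LA3-plan (g5)): the tree's LOCAL copy of `complexConj_smul_span_natCast` (4 l. incl. docstring)
-- is DELETED here; the landed ★ `Literature.NumberTheory.NumberFields.complexConj_smul_span_natCast`
-- (`GaloisConjugatePrimeIdealArithmetic.lean`) is cited by FQN at its use site(s) in this file.  Every other byte = tree ED. of record.

/-- **`𝔭_w² ∤ (p) ⇒ 𝔭_{c•w}² ∤ (p)`** (the `c•w` twin of the spine ED. 5 law (R-unr) `I.hunr`: `c` is an automorphism fixing `(p)`, ★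
`HeightOneSpectrum.smul_asIdeal_pow_dvd_smul_iff`). [cite: Neukirch1999, Ch. I §3 (3.6)] -/
theorem not_sq_smul_dvd_span_natCast (p : ℕ) (hunr : ¬ (w.asIdeal ^ 2 ∣ Ideal.span {((p : ℕ) : 𝓞 F)})) :
    ¬ (((IsCMField.complexConj F) • w).asIdeal ^ 2 ∣ Ideal.span {((p : ℕ) : 𝓞 F)}) := by
  rw [← Literature.NumberTheory.NumberFields.complexConj_smul_span_natCast (F := F) p, HeightOneSpectrum.smul_asIdeal_pow_dvd_smul_iff]
  exact hunr

end HsatIdeals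

section Hsat

open Literature.AlgebraicGeometry.GroupSchemes Literature.AlgebraicGeometry.GroupSchemes.GroupSchemeKernel

variable (I : RGDInputsAt F ι₁ Jstar K₀ S hU7ₛ hJ hJu Fi Kc G 𝓜 w hw h𝓨 θ e) [ExpChar (geomResidueField w) I.pChar]

/-- **(hsat) FROBENIUS SATURATION OF THE `c•w` BLOCK AT A SPECIAL POINT `x̄` — «`A_x̄[F_q] ∩ A_x̄[𝔭_{c•w}ⁿ] ⊆ A_x̄[𝔭_{c•w}]`».**  For every `n` and every
`T`-point `x` of the special fibre `A_x̄ = sch₀Of 𝓜 w 𝒜 x̄` killed by `𝔭_{c•w}ⁿ` and by the relative `q`-Frobenius `F_{A_x̄∕κ̄}^{(f)}` (`q = p^f`), `x` is killed by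
`𝔭_{c•w}` — the binder `hsat` of the `c•w`-block law (R3) `hlaw_cw_of_dockClauses` VERBATIM.  INPUTS: the dock `𝔡 : DockAt I x̄` (rows `hι₀G hkerG₀ hU₀ θU₀ hNU₀` by
projection — `G₀ = A_x̄[𝔭_{c•w}]` with monogenic unit component of exponent `p^{NU₀}`, `NU₀ ∈ {f, 2f}`) and the unramifiedness `𝔭_w² ∤ (p)` (spine (R-unr); its
`c•w` twin by §1).  PROOF: ★ `forall_comp_i_eq_one_of_pow_torsion_of_comp_relFrobeniusOver_eq_one` at `H := A_x̄[𝔭_{c•w}ⁿ]`, the ★ Serre kernel of a presentation of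
`𝔭_{c•w}ⁿ` (★ `exists_serrePresentation_of_ideal`, ★ `IdealTorsion.exists_comp_kerι_eq_iff_forall_mem ∕ isFinite_ker_hom ∕ flat_ker_hom`), `f ≤ NU₀` from `hNU₀`,
`𝔭_{c•w} ≤ 𝔭_{c•w}² + (p)` from §1. [cite: Liu2021, Prop. D.8 (3) p. 135, p. 137] [cite: Tate1997FiniteFlatGroupSchemes, (3.7)] [cite: Tate1967, §2.2 (proof of Prop. 1)]
[cite: Conrad2004GrossZagier, §7 (Thm. 7.5)] -/
theorem hsat_sch₀Of (xbar : AlgPoints (𝓜.localise w).reductionAt (geomResidueField w)) (𝔡 : DockAt I xbar)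
    (hunr : ¬ (w.asIdeal ^ 2 ∣ Ideal.span {((I.pChar : ℕ) : 𝓞 F)})) :
    ∀ (n : ℕ) ⦃T : SchemeOver (geomResidueField w)⦄ (x : T ⟶ (sch₀Of 𝓜 w I.univ xbar).X),
      (∀ b ∈ ((IsCMField.complexConj F) • w).asIdeal ^ n, x ≫ (act₀Of 𝓜 w I.univ I.act b xbar).hom.hom.hom = 1) →
      x ≫ relFrobeniusOver I.pChar I.fDeg (sch₀Of 𝓜 w I.univ xbar).X =
          (1 : T ⟶ ((sch₀Of 𝓜 w I.univ xbar).baseChange (frobSpec (geomResidueField w) I.pChar I.fDeg)).X) →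
      ∀ b ∈ ((IsCMField.complexConj F) • w).asIdeal, x ≫ (act₀Of 𝓜 w I.univ I.act b xbar).hom.hom.hom = 1 := by
  intro n T x hx hFx
  -- the characteristic, commutativity of the special fibre
  haveI : Fact I.pChar.Prime := ⟨I.hpChar.1⟩
  haveI : CharP (geomResidueField w) I.pChar := I.charP₀
  haveI : IsCommMonObj (sch₀Of 𝓜 w I.univ xbar).X := AbelianSchemeOver.isCommMonObj_of_field _
  -- the dock rows by projection; the action in `sch₀Of`-currency (the dock՚s `act`, base `Spec κ̄(w)` pinned by the expected type)
  letI := 𝔡.grp₀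
  haveI := 𝔡.aff₀
  haveI := 𝔡.fin₀
  letI := 𝔡.grpU₀
  haveI := 𝔡.affU₀
  let act' : RingAction (𝓞 F) (sch₀Of 𝓜 w I.univ xbar) :=
    (I.act.baseChange (pullback.fst (𝓜.localise w).total.hom (specResidueField w))).baseChange xbar.left
  have hf : I.fDeg ≤ 𝔡.NU₀ := by rcases 𝔡.hNU₀ with h | h <;> omega
  -- (R-unr) at `c•w`
  have hunr' : ((IsCMField.complexConj F) • w).asIdeal ≤
      ((IsCMField.complexConj F) • w).asIdeal ^ 2 ⊔ Ideal.span {((I.pChar : ℕ) : 𝓞 F)} :=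
    le_sq_sup_span_of_not_sq_dvd ((IsCMField.complexConj F) • w).isMaximal I.hpCharConj (not_sq_smul_dvd_span_natCast w I.pChar hunr)
  -- `H := A_x̄[𝔭_{c•w}ⁿ]`, the Serre kernel of a presentation of `𝔭_{c•w}ⁿ`
  obtain ⟨m, E, hE, P, Q, N, hN, hEP, hQE, hQP, hPQ, hspan, -, -⟩ :=
    Literature.NumberTheory.NumberFields.SerrePresentation.exists_serrePresentation_of_ideal (((IsCMField.complexConj F) • w).asIdeal ^ n)
      (pow_ne_zero _ ((IsCMField.complexConj F) • w).ne_bot)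
  haveI := isMonHom_serreTranslate act' E hE P
  haveI := IdealTorsion.isFinite_ker_hom act' E hE P Q hN hEP hQE hQP hPQ
  haveI := IdealTorsion.flat_ker_hom act' E hE P Q hN hEP hQE hQP hPQ
  haveI := IdealTorsion.isClosedImmersion_kerι_serreTranslate_left act' E hE P
  have hkerH : ∀ ⦃T : SchemeOver (geomResidueField w)⦄ (t : T ⟶ (sch₀Of 𝓜 w I.univ xbar).X),
      (∀ r ∈ ((IsCMField.complexConj F) • w).asIdeal ^ n, t ≫ act'.i r = 1) ↔
        ∃ s : T ⟶ ker (serreTranslate act' E hE P), s ≫ kerι (serreTranslate act' E hE P) = t :=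
    fun T t => (IdealTorsion.exists_comp_kerι_eq_iff_forall_mem act' E hE P hEP hspan t).symm
  have h := forall_comp_i_eq_one_of_pow_torsion_of_comp_relFrobeniusOver_eq_one I.pChar I.fDeg (sch₀Of 𝓜 w I.univ xbar) act'
    ((IsCMField.complexConj F) • w).asIdeal hunr' 𝔡.G₀ 𝔡.ι₀G 𝔡.hι₀G 𝔡.hkerG₀ 𝔡.U₀ 𝔡.jU₀ 𝔡.hU₀ 𝔡.θU₀ hf
    (ker (serreTranslate act' E hE P)) (kerι (serreTranslate act' E hE P)) ⟨inferInstance, inferInstance⟩ hkerH x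
    (fun b hb => hx b hb) hFx
  intro b hb
  exact h b hb

end Hsat

end Summit.HodgeConjecture.HodgeConjecture.Cruxes.HLiu418.F0P6aRoofCwKernel

end
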